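import Mathlib
import Literature.Analysis.FluidPDE.KNSSMildGradientBound
import Literature.Analysis.UnboundedOperators.HeatKernelBoundedData

/-!
# Route LevelSetModeration — `HighSpeedPressureWork`: elementary estimates for the log-free fast-set bound

Support file for item stmt-NavierStokesRegularity-18149 (`HighSpeedPressureWork`), stub
`stub_earlyBookkeeping` (margin zero): the real-variable bookkeeping of the log-free fast-set
speed-gradient bound (`…FastSetGradientLogFreeUnit.lean`):

* `fastSet_heatExtension_nonneg` — caloric extensions of nonnegative bounded data are nonnegative;
* `fastSet_rpow_mul_sqrt_log_le` — `y^{3/8} √(log(1/y)) ≤ 2` (`log z ≤ z^{3/4}/(3/4)`);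
* `fastSet_mul_sqrt_le` — `t √ℓ ≤ √2 √t` for `ℓ ≤ 2 log(1/t)`, `0 < t ≤ 1` (`log(1/t) ≤ 1/t`);
* `fastSet_integral_sourceBound_le` — the time integral of the one-slice source majorant
  `2C_S (t−σ)^{-1/2}(κ ((t−s₀)/(σ−s₀))^{3/4} + 2C_D √t) + 4C_F/(√(t−σ) √ℓ)` over `(s₀, t)` is at most
  `24 C_S κ √t + 8 C_S C_D t + 8 C_F √t/√ℓ` (Beta-type integrals of `KNSSMildGradientBound.lean`).
-/

noncomputable section

-- single-conjunct summit: `Summit.<Summit>.<Problem>` repeats the name by the D-0017 layout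
set_option linter.dupNamespace false

namespace Summit.NavierStokesRegularity.NavierStokesRegularity.Theorems

open MeasureTheory Set Filter Topology Function
open scoped ENNReal RealInnerProductSpace
open Literature.Analysis.FluidPDE
open Literature.Analysis.UnboundedOperators (heatExtension heatKernel heatExtension_apply
  heatKernel_pos)

/-- **Caloric extensions of nonnegative data are nonnegative** (`0 < θ`). [folklore] -/
theorem fastSet_heatExtension_nonneg {E : Type*} [NormedAddCommGroup E] [InnerProductSpace ℝ E]
    [FiniteDimensional ℝ E] [MeasurableSpace E] [BorelSpace E] {g : E → ℝ} (hg0 : ∀ z, 0 ≤ g z)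
    {θ : ℝ} (hθ : 0 < θ) (y : E) : 0 ≤ heatExtension g θ y := by
  rw [heatExtension_apply]
  refine integral_nonneg fun z => ?_
  dsimp only
  rw [smul_eq_mul]
  exact mul_nonneg (heatKernel_pos hθ z).le (hg0 _)

/-- `y^{3/8} √(log(1/y)) ≤ 2` for `0 < y` (from `log z ≤ z^{3/4}/(3/4)`). [folklore] -/
theorem fastSet_rpow_mul_sqrt_log_le {y : ℝ} (hy : 0 < y) :
    y ^ (3 / 8 : ℝ) * Real.sqrt (Real.log (1 / y)) ≤ 2 := by
  set ℓ : ℝ := Real.log (1 / y) with hℓ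
  rcases le_or_gt ℓ 0 with hℓ0 | hℓ0
  · rw [Real.sqrt_eq_zero_of_nonpos hℓ0, mul_zero]; norm_num
  · -- `y^{3/4} ℓ ≤ 4/3`
    have h1 : ℓ ≤ (1 / y) ^ (3 / 4 : ℝ) / (3 / 4) := Real.log_le_rpow_div (by positivity) (by norm_num)
    have h2 : y ^ (3 / 4 : ℝ) * (1 / y) ^ (3 / 4 : ℝ) = 1 := by
      rw [← Real.mul_rpow hy.le (by positivity), mul_one_div_cancel hy.ne', Real.one_rpow]
    have h3 : y ^ (3 / 4 : ℝ) * ℓ ≤ 4 / 3 := by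
      calc y ^ (3 / 4 : ℝ) * ℓ ≤ y ^ (3 / 4 : ℝ) * ((1 / y) ^ (3 / 4 : ℝ) / (3 / 4)) :=
            mul_le_mul_of_nonneg_left h1 (Real.rpow_nonneg hy.le _)
        _ = (y ^ (3 / 4 : ℝ) * (1 / y) ^ (3 / 4 : ℝ)) / (3 / 4) := by ring
        _ = 4 / 3 := by rw [h2]; norm_num
    have h4 : y ^ (3 / 8 : ℝ) = Real.sqrt (y ^ (3 / 4 : ℝ)) := by
      rw [Real.sqrt_eq_rpow, ← Real.rpow_mul hy.le]; norm_num
    rw [h4, ← Real.sqrt_mul (Real.rpow_nonneg hy.le _)]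
    calc Real.sqrt (y ^ (3 / 4 : ℝ) * ℓ) ≤ Real.sqrt 4 := Real.sqrt_le_sqrt (by linarith)
      _ = 2 := by rw [show (4 : ℝ) = 2 ^ 2 by norm_num, Real.sqrt_sq (by norm_num)]

/-- `t √ℓ ≤ √2 √t` whenever `0 < t`, `0 ≤ ℓ ≤ 2 log(1/t)` (`log(1/t) ≤ 1/t`). [folklore] -/
theorem fastSet_mul_sqrt_le {t ℓ : ℝ} (ht : 0 < t) (hℓ : ℓ ≤ 2 * Real.log (1 / t)) :
    t * Real.sqrt ℓ ≤ Real.sqrt 2 * Real.sqrt t := by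
  have h1 : Real.log (1 / t) ≤ 1 / t := by
    have := Real.log_le_sub_one_of_pos (by positivity : (0 : ℝ) < 1 / t)
    linarith [show (0 : ℝ) ≤ 1 by norm_num]
  have h2 : ℓ ≤ 2 / t := by
    calc ℓ ≤ 2 * Real.log (1 / t) := hℓ
      _ ≤ 2 * (1 / t) := by linarith
      _ = 2 / t := by ring
  have h3 : Real.sqrt ℓ ≤ Real.sqrt 2 / Real.sqrt t := by
    rw [← Real.sqrt_div (by norm_num : (0 : ℝ) ≤ 2)]
    exact Real.sqrt_le_sqrt h2
  have hst : 0 < Real.sqrt t := Real.sqrt_pos.2 ht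
  calc t * Real.sqrt ℓ ≤ t * (Real.sqrt 2 / Real.sqrt t) := mul_le_mul_of_nonneg_left h3 ht.le
    _ = Real.sqrt 2 * (t / Real.sqrt t) := by ring
    _ = Real.sqrt 2 * Real.sqrt t := by rw [Real.div_sqrt]

/-- **Time integral of the one-slice source majorant.** For `0 ≤ s₀ < t`, `κ ≥ 0`, `ℓ > 0` and
nonnegative constants `C_S, C_D, C_F`, the majorant
`σ ↦ 2C_S (t−σ)^{-1/2} (κ ((t−s₀)/(σ−s₀))^{3/4} + 2 C_D √t) + 4 C_F /(√(t−σ) √ℓ)`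
is integrable on `(s₀, t)` with integral at most `24 C_S κ √t + 8 C_S C_D t + 8 C_F √t/√ℓ`
(`∫ (t−σ)^{-1/2}(σ−s₀)^{-3/4} ≤ 6·2^{1/4}(t−s₀)^{-1/4}`, `∫ (t−σ)^{-1/2} = 2√(t−s₀)`). [folklore] -/
theorem fastSet_integral_sourceBound_le :
    ∀ {s₀ t κ ℓ CS CD CF : ℝ}, 0 ≤ s₀ → s₀ < t → 0 ≤ κ → 0 < ℓ → 0 ≤ CS → 0 ≤ CD → 0 ≤ CF → MeasureTheory.IntegrableOn (fun σ => 2 * CS * (t - σ) ^ (-(1 / 2 : ℝ)) * (κ * ((t - s₀) / (σ - s₀)) ^ (3 / 4 : ℝ) + 2 * CD * Real.sqrt t) + 4 * CF / (Real.sqrt (t - σ) * Real.sqrt ℓ)) (Set.Ioo s₀ t) MeasureTheory.volume ∧ (∫ σ in Set.Ioo s₀ t, (2 * CS * (t - σ) ^ (-(1 / 2 : ℝ)) * (κ * ((t - s₀) / (σ - s₀)) ^ (3 / 4 : ℝ) + 2 * CD * Real.sqrt t) + 4 * CF / (Real.sqrt (t - σ) * Real.sqrt ℓ))) ≤ 24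 * CS * κ * Real.sqrt t + 8 * CS * CD * t + 8 * CF * Real.sqrt t / Real.sqrt ℓ := by
  intro s₀ t κ ℓ CS CD CF hs₀ hst hκ hℓ hCS hCD hCF
  have ht : 0 < t := hs₀.trans_lt hst
  have hts : 0 < t - s₀ := sub_pos.2 hst
  have hsqℓ : 0 < Real.sqrt ℓ := Real.sqrt_pos.2 hℓ
  -- the two basic weights
  set w₁ : ℝ → ℝ := fun σ => (t - σ) ^ (-(1 / 2 : ℝ)) * (σ - s₀) ^ (-(3 / 4 : ℝ)) with hw₁
  set w₂ : ℝ → ℝ := fun σ => (t - σ) ^ (-(1 / 2 : ℝ)) with hw₂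
  have hI₁ := intervalIntegrable_rpow_neg_mul_rpow_neg (a := 1 / 2) (b := 3 / 4) (s := s₀) (t := t)
    (by norm_num) (by norm_num) hst
  have i₁ : IntegrableOn w₁ (Ioo s₀ t) volume := (hI₁.1).mono_set Ioo_subset_Ioc_self
  have hI₂ : IntervalIntegrable w₂ volume s₀ t := by
    have := ((intervalIntegral.intervalIntegrable_rpow' (a := t - s₀) (b := 0)
      (by norm_num : (-1 : ℝ) < -(1 / 2 : ℝ))).comp_sub_left t)
    simpa [hw₂] using this
  have i₂ : IntegrableOn w₂ (Ioo s₀ t) volume := (hI₂.1).mono_set Ioo_subset_Ioc_self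
  -- rewrite the majorant on `(s₀, t)` as a combination of the weights
  set A₁ : ℝ := 2 * CS * κ * (t - s₀) ^ (3 / 4 : ℝ) with hA₁
  set A₂ : ℝ := 4 * CS * CD * Real.sqrt t + 4 * CF / Real.sqrt ℓ with hA₂
  have hA₁0 : 0 ≤ A₁ := by rw [hA₁]; exact mul_nonneg (by positivity) (Real.rpow_nonneg hts.le _)
  have hA₂0 : 0 ≤ A₂ := by rw [hA₂]; positivity
  have heq : ∀ σ ∈ Ioo s₀ t, 2 * CS * (t - σ) ^ (-(1 / 2 : ℝ)) *
      (κ * ((t - s₀) / (σ - s₀)) ^ (3 / 4 : ℝ) + 2 * CD * Real.sqrt t) +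
      4 * CF / (Real.sqrt (t - σ) * Real.sqrt ℓ) = A₁ * w₁ σ + A₂ * w₂ σ := by
    intro σ hσ
    have h1 : 0 < t - σ := sub_pos.2 hσ.2
    have h2 : 0 < σ - s₀ := sub_pos.2 hσ.1
    have hdiv : ((t - s₀) / (σ - s₀)) ^ (3 / 4 : ℝ) = (t - s₀) ^ (3 / 4 : ℝ) * (σ - s₀) ^ (-(3 / 4 : ℝ)) := by
      rw [Real.div_rpow hts.le h2.le, Real.rpow_neg h2.le, div_eq_mul_inv]
    have hsq : Real.sqrt (t - σ) = ((t - σ) ^ (-(1 / 2 : ℝ)))⁻¹ := by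
      rw [Real.rpow_neg h1.le, inv_inv, Real.sqrt_eq_rpow]
    have hw1 : w₁ σ = (t - σ) ^ (-(1 / 2 : ℝ)) * (σ - s₀) ^ (-(3 / 4 : ℝ)) := rfl
    have hw2 : w₂ σ = (t - σ) ^ (-(1 / 2 : ℝ)) := rfl
    have hpos : 0 < (t - σ) ^ (-(1 / 2 : ℝ)) := Real.rpow_pos_of_pos h1 _
    rw [hdiv, hsq, hw1, hw2, hA₁, hA₂]
    field_simp
    ring
  -- integrability
  have hint : IntegrableOn (fun σ => A₁ * w₁ σ + A₂ * w₂ σ) (Ioo s₀ t) volume :=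
    (i₁.const_mul A₁).add (i₂.const_mul A₂)
  refine ⟨hint.congr_fun (fun σ hσ => (heq σ hσ).symm) measurableSet_Ioo, ?_⟩
  rw [setIntegral_congr_fun measurableSet_Ioo heq, integral_add (i₁.const_mul A₁) (i₂.const_mul A₂),
    integral_const_mul, integral_const_mul]
  -- the two integrals
  have hv₁ : ∫ σ in Ioo s₀ t, w₁ σ ≤ 12 * (t - s₀) ^ (-(1 / 4 : ℝ)) := by
    rw [← integral_Ioc_eq_integral_Ioo, ← intervalIntegral.integral_of_le hst.le]
    have h := integral_rpow_neg_mul_rpow_neg_le (a := 1 / 2) (b := 3 / 4) (s := s₀) (t := t)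
      (by norm_num) (by norm_num) (by norm_num) (by norm_num) hst
    refine h.trans ?_
    rw [show (1 : ℝ) / 2 + 3 / 4 - 1 = 1 / 4 by norm_num, show (1 : ℝ) - 1 / 2 - 3 / 4 = -(1 / 4) by norm_num]
    have h2 : (2 : ℝ) ^ (1 / 4 : ℝ) ≤ 2 := by
      calc (2 : ℝ) ^ (1 / 4 : ℝ) ≤ (2 : ℝ) ^ (1 : ℝ) :=
            Real.rpow_le_rpow_of_exponent_le (by norm_num) (by norm_num)
        _ = 2 := Real.rpow_one 2
    have h3 : 0 ≤ (t - s₀) ^ (-(1 / 4 : ℝ)) := Real.rpow_nonneg hts.le _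
    have h4 : (2 : ℝ) ^ (1 / 4 : ℝ) / (1 - 3 / 4) + (2 : ℝ) ^ (1 / 4 : ℝ) / (1 - 1 / 2) ≤ 12 := by
      rw [show (1 : ℝ) - 3 / 4 = 1 / 4 by norm_num, show (1 : ℝ) - 1 / 2 = 1 / 2 by norm_num]
      have : (2 : ℝ) ^ (1 / 4 : ℝ) / (1 / 4) + (2 : ℝ) ^ (1 / 4 : ℝ) / (1 / 2) = 6 * (2 : ℝ) ^ (1 / 4 : ℝ) := by
        ring
      rw [this]; linarith
    exact mul_le_mul_of_nonneg_right h4 h3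
  have hv₂ : ∫ σ in Ioo s₀ t, w₂ σ = 2 * Real.sqrt (t - s₀) := by
    rw [← integral_Ioc_eq_integral_Ioo, ← intervalIntegral.integral_of_le hst.le]
    simp only [hw₂]
    rw [integral_rpow_sub_left_eq (by norm_num : (-1 : ℝ) < -(1 / 2 : ℝ)),
      show -(1 / 2 : ℝ) + 1 = 1 / 2 by norm_num, ← Real.sqrt_eq_rpow]
    ring
  -- `A₁ · 12 (t-s₀)^{-1/4} = 24 CS κ (t-s₀)^{1/2} ≤ 24 CS κ √t`
  have hP1 : A₁ * (12 * (t - s₀) ^ (-(1 / 4 : ℝ))) ≤ 24 * CS * κ * Real.sqrt t := by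
    have h1 : (t - s₀) ^ (3 / 4 : ℝ) * (t - s₀) ^ (-(1 / 4 : ℝ)) = Real.sqrt (t - s₀) := by
      rw [← Real.rpow_add hts, Real.sqrt_eq_rpow]; norm_num
    have h2 : Real.sqrt (t - s₀) ≤ Real.sqrt t := Real.sqrt_le_sqrt (by linarith)
    calc A₁ * (12 * (t - s₀) ^ (-(1 / 4 : ℝ)))
        = 24 * CS * κ * ((t - s₀) ^ (3 / 4 : ℝ) * (t - s₀) ^ (-(1 / 4 : ℝ))) := by rw [hA₁]; ring
      _ = 24 * CS * κ * Real.sqrt (t - s₀) := by rw [h1]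
      _ ≤ 24 * CS * κ * Real.sqrt t := mul_le_mul_of_nonneg_left h2 (by positivity)
  have hP2 : A₂ * (2 * Real.sqrt (t - s₀)) ≤ 8 * CS * CD * t + 8 * CF * Real.sqrt t / Real.sqrt ℓ := by
    have h2 : Real.sqrt (t - s₀) ≤ Real.sqrt t := Real.sqrt_le_sqrt (by linarith)
    have h3 : Real.sqrt t * Real.sqrt t = t := Real.mul_self_sqrt ht.le
    calc A₂ * (2 * Real.sqrt (t - s₀)) ≤ A₂ * (2 * Real.sqrt t) :=
          mul_le_mul_of_nonneg_left (by linarith) hA₂0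
      _ = 8 * CS * CD * (Real.sqrt t * Real.sqrt t) + 8 * CF * Real.sqrt t / Real.sqrt ℓ := by
          rw [hA₂]; field_simp; ring
      _ = _ := by rw [h3]
  calc (A₁ * ∫ σ in Ioo s₀ t, w₁ σ) + A₂ * ∫ σ in Ioo s₀ t, w₂ σ
      ≤ A₁ * (12 * (t - s₀) ^ (-(1 / 4 : ℝ))) + A₂ * (2 * Real.sqrt (t - s₀)) := by
        rw [hv₂]
        exact add_le_add (mul_le_mul_of_nonneg_left hv₁ hA₁0) le_rfl
    _ ≤ 24 * CS * κ * Real.sqrt t + (8 * CS * CD * t + 8 * CF * Real.sqrt t / Real.sqrt ℓ) :=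
        add_le_add hP1 hP2
    _ = 24 * CS * κ * Real.sqrt t + 8 * CS * CD * t + 8 * CF * Real.sqrt t / Real.sqrt ℓ := by ring

end Summit.NavierStokesRegularity.NavierStokesRegularity.Theorems

end
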